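import Literature.Barriers.Parity.EquidistributionLimits
import Literature.NumberTheory.LFunctions.MertensConstant
import Literature.NumberTheory.Sieve.ParityWave0Proofs
import HarnessLib

/-!
# Maier's matrix method: rows, columns and the bookkeeping lemmas

Topic `Literature/Barriers/Parity` (support file for `EquidistributionLimitsProofs.lean`, which
proves `Literature.Barriers.Parity.Maier1985_shortIntervals`). Everything here is PROVED; there are
no definitions. Grouping namespace `Literature.Barriers.Parity.Maier`.

For a modulus `P`, a width `h` and a height range `⌊N/P⌋ < r ≤ ⌊2N/P⌋` consider the "Maier
matrix" of integers `rP + j`, `1 ≤ j ≤ h` (Maier 1985; Soundararajan 2007, Lecture 3,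
(3.1)–(3.4)). This file provides the mechanics of counting its primes twice:

* `ψ(x; q, a)` bookkeeping for the tree's `Literature.NumberTheory.Sieve.ParityWave0.chebyshevPsiMod`:
  differences over `(N, M]`, and the two "gap" facts that a residue class `j mod P`
  has no member in `(⌊x/P⌋P + j, x]` (`chebyshevPsiMod_le_div_mul_add`) and at most one member
  in an interval shorter than `P` (`chebyshevPsiMod_add_le`);
* rows: `π(x + h) − π(x) = #{0 ≤ i < h : x + (i+1) prime}` (`primeCounting_add_eq`, via
  `Nat.count_add`) and its relation to the tree's `primesInInterval` (`primesInInterval_natCast`,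
  `primesInInterval_mono`);
* columns: reindexing `r ↦ rP + j` (`sum_Ioc_mul_add_eq`), the log-weighted column sum as a
  difference of `ϑ(·; P, j)` (`columnLogSum_eq`) and its comparison with `ψ(·; P, j)` through the
  tree's sandwich `Literature.NumberTheory.Sieve.sum_log_prime_modEq_le_chebyshevPsiMod` and
  Mathlib's `Chebyshev.psi_sub_theta_le` (`columnLogSum_ge`, `columnLogSum_le`, `column_bounds`:
  if `ψ(x; P, j) = (1 ± ε) x/φ(P)` at `x = N, 2N` then the column of `j` holds `C_j` primes with
  `(1 − 4ε)N/φ(P) ≤ C_j log(3N)` and `C_j log N ≤ (1 + 4ε)N/φ(P)`);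
* double counting and pigeonhole (`sum_rows_eq_sum_columns`, `card_column_eq_zero`,
  `card_rows_bounds`, `exists_row_ge`, `exists_row_le`): some row has at least
  `N_c (P/φ(P))(1 − 5ε)/log(3N)` and some row at most `N_c (P/φ(P))(1 + 7ε)/log N` primes, where
  `N_c = #{1 ≤ j ≤ h : (j, P) = 1}`;
* elementary asymptotics in `L = log N` used to fix the parameters (`eventually_const_mul_rpow_le`,
  `eventually_add_rpow_le`, `eventually_lengths_le`, `eventually_linear_le_exp`) and Mertens'
  theorem in a window `∑_{L^c < p ≤ L^b} 1/p → log b − log c`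
  (`eventually_abs_primeRecipSum_window`, from the tree's
  `Literature.NumberTheory.LFunctions.Mertens.tendsto_primeRecipSum_sub_loglog`);
* small glue (`card_range_filter_succ`, `sum_inv_erase_ge`, `coprime_prod_of_notMem`).

## References

* H. Maier, *Primes in short intervals*, Michigan Math. J. 32 (1985), 221–225 (`Maier1985`).
* K. Soundararajan, *The distribution of prime numbers* (2007), arXiv:math/0606408, Lecture 3
  (`Soundararajan2007Distribution`).
* H. L. Montgomery, R. C. Vaughan, *Multiplicative Number Theory I* (CUP 2007), proof of
  Cor. 11.20 (`MontgomeryVaughan2007`).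
-/

noncomputable section

open Filter Finset
open scoped ArithmeticFunction.vonMangoldt

namespace Literature.Barriers.Parity.Maier

open Literature.NumberTheory.Sieve.ParityWave0 (chebyshevPsiMod)

/-! ## `ψ(x; q, a)`: monotonicity and gaps between the members of a residue class -/

/-- `ψ(M; q, a) − ψ(N; q, a) = ∑_{N < n ≤ M} Λ(n)𝟙_{n ≡ a}` for naturals `N ≤ M`. [folklore] -/
theorem chebyshevPsiMod_natCast_sub (q : ℕ) (a : ZMod q) {N M : ℕ} (h : N ≤ M) :
    chebyshevPsiMod q a M - chebyshevPsiMod q a N =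
      ∑ n ∈ Ioc N M, ArithmeticFunction.vonMangoldt.residueClass a n := by
  unfold chebyshevPsiMod
  rw [Nat.floor_natCast, Nat.floor_natCast, range_eq_Ico, range_eq_Ico,
    ← sum_Ico_consecutive _ (Nat.zero_le (N + 1)) (by omega : N + 1 ≤ M + 1)]
  have : Ico (N + 1) (M + 1) = Ioc N M := by ext n; simp only [mem_Ico, mem_Ioc]; omega
  rw [this]; ring

/-- A term of `ψ(·; q, a)` vanishes off the residue class. [folklore] -/
theorem residueClass_eq_zero_of_ne {q : ℕ} {a : ZMod q} {n : ℕ} (h : (n : ZMod q) ≠ a) :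
    ArithmeticFunction.vonMangoldt.residueClass a n = 0 := by
  simp [ArithmeticFunction.vonMangoldt.residueClass, Set.indicator_of_notMem, h]

/-- A term of `ψ(·; q, a)` is at most `log n`. [folklore] -/
theorem residueClass_le_log {q : ℕ} (a : ZMod q) (n : ℕ) :
    ArithmeticFunction.vonMangoldt.residueClass a n ≤ Real.log n :=
  (ArithmeticFunction.vonMangoldt.residueClass_le a n).trans ArithmeticFunction.vonMangoldt_le_log

/-- **No member of the class `j (mod P)` lies in `(⌊x/P⌋P + j, x]`**: for `0 < P` and natural `x, j`,
`ψ(x; P, j) ≤ ψ(⌊x/P⌋ P + j; P, j)`. [folklore] -/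
theorem chebyshevPsiMod_le_div_mul_add {P : ℕ} (hP : 0 < P) (j x : ℕ) :
    chebyshevPsiMod P (j : ZMod P) x ≤ chebyshevPsiMod P (j : ZMod P) ((x / P * P + j : ℕ) : ℝ) := by
  by_cases hle : x ≤ x / P * P + j
  · -- monotonicity of `ψ(·; P, j)` (the tree's `Literature.NumberTheory.Sieve.chebyshevPsiMod_mono`
    -- is stated for the `LevelOfDistribution` copy of `ψ`; here the one-line proof is repeated)
    unfold chebyshevPsiMod
    refine sum_le_sum_of_subset_of_nonneg (range_subset_range.2 (Nat.succ_le_succ (Nat.floor_mono ?_)))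
      fun n _ _ ↦ ArithmeticFunction.vonMangoldt.residueClass_nonneg _ n
    exact_mod_cast hle
  push Not at hle
  have hsub := chebyshevPsiMod_natCast_sub P (j : ZMod P) hle.le
  suffices hz : ∑ n ∈ Ioc (x / P * P + j) x, ArithmeticFunction.vonMangoldt.residueClass (j : ZMod P) n = 0 by
    linarith
  refine sum_eq_zero fun n hn ↦ residueClass_eq_zero_of_ne fun hnj ↦ ?_
  rw [mem_Ioc] at hn
  have hmod : n ≡ j [MOD P] := (ZMod.natCast_eq_natCast_iff n j P).1 hnj
  have hjn : j ≤ n := by omega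
  obtain ⟨m, hm⟩ := (Nat.modEq_iff_dvd' hjn).1 hmod.symm
  -- `n − j = P m` with `m > x / P`, so `n ≥ (x/P + 1) P + j > x`
  have h1 : x / P * P < P * m := by omega
  have h2 : x / P < m := by
    rw [mul_comm] at h1
    exact Nat.lt_of_mul_lt_mul_left h1
  have h3 : P * (x / P + 1) ≤ P * m := Nat.mul_le_mul_left P h2
  have h4 : x < x / P * P + P := Nat.lt_div_mul_add hP
  have h5 : P * (x / P + 1) = x / P * P + P := by ring
  omega

/-- **At most one member of the class `j (mod P)` in an interval shorter than `P`**: for `h < P`,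
`ψ(x + h; P, j) ≤ ψ(x; P, j) + log(x + h)`. [folklore] -/
theorem chebyshevPsiMod_add_le {P h : ℕ} (hh : h < P) (j x : ℕ) :
    chebyshevPsiMod P (j : ZMod P) ((x + h : ℕ) : ℝ) ≤
      chebyshevPsiMod P (j : ZMod P) x + Real.log ((x + h : ℕ) : ℝ) := by
  classical
  have hsub := chebyshevPsiMod_natCast_sub P (j : ZMod P) (Nat.le_add_right x h)
  suffices hz : ∑ n ∈ Ioc x (x + h), ArithmeticFunction.vonMangoldt.residueClass (j : ZMod P) n ≤
      Real.log ((x + h : ℕ) : ℝ) by linarith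
  have hlog0 : 0 ≤ Real.log ((x + h : ℕ) : ℝ) := Real.log_natCast_nonneg _
  -- only the `n ≡ j` contribute, there is at most one of them, and each term is `≤ log(x+h)`
  rw [← sum_filter_add_sum_filter_not (Ioc x (x + h)) (fun n : ℕ ↦ (n : ZMod P) = (j : ZMod P))]
  have hz : ∑ n ∈ (Ioc x (x + h)).filter (fun n : ℕ ↦ ¬ (n : ZMod P) = (j : ZMod P)),
      ArithmeticFunction.vonMangoldt.residueClass (j : ZMod P) n = 0 :=
    sum_eq_zero fun n hn ↦ residueClass_eq_zero_of_ne (mem_filter.1 hn).2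
  rw [hz, add_zero]
  have hcard : #((Ioc x (x + h)).filter (fun n : ℕ ↦ (n : ZMod P) = (j : ZMod P))) ≤ 1 := by
    refine card_le_one.2 fun n hn n' hn' ↦ ?_
    simp only [mem_filter, mem_Ioc] at hn hn'
    have hmod : n ≡ n' [MOD P] :=
      (ZMod.natCast_eq_natCast_iff n n' P).1 (hn.2.trans hn'.2.symm)
    refine Nat.ModEq.eq_of_abs_lt hmod ?_
    rw [abs_lt]
    constructor <;> omega
  calc ∑ n ∈ (Ioc x (x + h)).filter (fun n : ℕ ↦ (n : ZMod P) = (j : ZMod P)),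
        ArithmeticFunction.vonMangoldt.residueClass (j : ZMod P) n
      ≤ ∑ n ∈ (Ioc x (x + h)).filter (fun n : ℕ ↦ (n : ZMod P) = (j : ZMod P)),
          Real.log ((x + h : ℕ) : ℝ) := by
        refine sum_le_sum fun n hn ↦ (residueClass_le_log _ n).trans ?_
        simp only [mem_filter, mem_Ioc] at hn
        exact Real.log_le_log (by exact_mod_cast (by omega : 0 < n)) (by exact_mod_cast hn.1.2)
    _ = #((Ioc x (x + h)).filter (fun n : ℕ ↦ (n : ZMod P) = (j : ZMod P))) * Real.log ((x + h : ℕ) : ℝ) := by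
        rw [sum_const, nsmul_eq_mul]
    _ ≤ 1 * Real.log ((x + h : ℕ) : ℝ) := by
        exact mul_le_mul_of_nonneg_right (by exact_mod_cast hcard) hlog0
    _ = _ := one_mul _

/-! ## Rows and columns of the Maier matrix `(rP + 1 + k)`, `R₁ < r ≤ R₂`, `0 ≤ k < h` -/

/-- Reindexing a column: `∑_{R₁ < r ≤ R₂} f(rP + j) = ∑_{R₁P + j < n ≤ R₂P + j, n ≡ j (P)} f(n)`.
[folklore] -/
theorem sum_Ioc_mul_add_eq (f : ℕ → ℝ) {P : ℕ} (hP : 0 < P) (j R₁ R₂ : ℕ) :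
    ∑ r ∈ Ioc R₁ R₂, f (r * P + j) =
      ∑ n ∈ (Ioc (R₁ * P + j) (R₂ * P + j)).filter (fun n ↦ n ≡ j [MOD P]), f n := by
  refine sum_nbij' (fun r ↦ r * P + j) (fun n ↦ (n - j) / P) (fun r hr ↦ ?_) (fun n hn ↦ ?_)
    (fun r _ ↦ ?_) (fun n hn ↦ ?_) (fun _ _ ↦ rfl)
  · rw [mem_Ioc] at hr
    refine mem_filter.2 ⟨mem_Ioc.2 ⟨?_, ?_⟩, (Nat.mul_add_mod' r P j : (r * P + j) % P = j % P)⟩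
    · exact Nat.add_lt_add_right (Nat.mul_lt_mul_of_pos_right hr.1 hP) j
    · exact Nat.add_le_add_right (Nat.mul_le_mul_right P hr.2) j
  · simp only [mem_filter, mem_Ioc] at hn
    obtain ⟨⟨hn1, hn2⟩, hmod⟩ := hn
    have hjn : j ≤ n := by omega
    obtain ⟨m, hm⟩ := (Nat.modEq_iff_dvd' hjn).1 hmod.symm
    have hm' : (n - j) / P = m := by rw [hm, Nat.mul_div_cancel_left m hP]
    rw [hm', mem_Ioc]
    constructor
    · have : R₁ * P < m * P := by rw [mul_comm m]; omega
      exact Nat.lt_of_mul_lt_mul_right this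
    · have : m * P ≤ R₂ * P := by rw [mul_comm m]; omega
      exact Nat.le_of_mul_le_mul_right this hP
  · show (r * P + j - j) / P = r
    rw [Nat.add_sub_cancel, Nat.mul_div_cancel r hP]
  · simp only [mem_filter, mem_Ioc] at hn
    obtain ⟨⟨hn1, _⟩, hmod⟩ := hn
    have hjn : j ≤ n := by omega
    have hdvd : P ∣ n - j := (Nat.modEq_iff_dvd' hjn).1 hmod.symm
    show (n - j) / P * P + j = n
    rw [Nat.div_mul_cancel hdvd]
    omega

/-- A row: `π(x + h) − π(x) = #{0 ≤ k < h : x + (k + 1) prime}`. [folklore] -/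
theorem primeCounting_add_eq (x h : ℕ) :
    Nat.primeCounting (x + h) = Nat.primeCounting x + #{k ∈ range h | (x + (k + 1)).Prime} := by
  rw [Nat.primeCounting, Nat.primeCounting, Nat.primeCounting', show x + h + 1 = (x + 1) + h by ring,
    Nat.count_add, Nat.count_eq_card_filter_range, Nat.count_eq_card_filter_range]
  congr 1
  exact congrArg Finset.card (filter_congr fun k _ ↦ by rw [show x + 1 + k = x + (k + 1) by ring])

/-- The tree's `primesInInterval x h` for a natural length `h` is `π(x + h) − π(x)`, i.e. the row
count `#{0 ≤ k < h : x + (k + 1) prime}`. [folklore] -/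
theorem primesInInterval_natCast (x h : ℕ) :
    primesInInterval x (h : ℝ) = #{k ∈ range h | (x + (k + 1)).Prime} := by
  rw [primesInInterval, ← Nat.cast_add, Nat.floor_natCast, primeCounting_add_eq, Nat.add_sub_cancel_left]

/-- Monotonicity of `primesInInterval x ·` in the (real) length. [folklore] -/
theorem primesInInterval_mono (x : ℕ) {h h' : ℝ} (hh : h ≤ h') :
    primesInInterval x h ≤ primesInInterval x h' := by
  unfold primesInInterval
  exact Nat.sub_le_sub_right (Nat.monotone_primeCounting (Nat.floor_mono (by linarith))) _

/-- **Double counting**: the number of primes in the matrix counted by rows equals the count by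
columns. [cite: Soundararajan2007Distribution, Lecture 3 (3.1a)–(3.2)] -/
theorem sum_rows_eq_sum_columns (P h R₁ R₂ : ℕ) :
    ∑ r ∈ Ioc R₁ R₂, (#{k ∈ range h | (r * P + (k + 1)).Prime} : ℝ) =
      ∑ k ∈ range h, (#{r ∈ Ioc R₁ R₂ | (r * P + (k + 1)).Prime} : ℝ) := by
  simp only [card_filter, Nat.cast_sum, Nat.cast_ite, Nat.cast_one, Nat.cast_zero]
  exact sum_comm

/-- **A column whose residue is not coprime to `P` contains no prime** (for rows `r ≥ 1`): if
`(k + 1, P) ≠ 1` then `rP + (k + 1)` has a prime factor `p ∣ P`, `p ≤ P ≤ rP < rP + k + 1`.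
[cite: Soundararajan2007Distribution, Lecture 3 (before (3.2))] -/
theorem card_column_eq_zero {P : ℕ} (hP : 0 < P) {k : ℕ} (hk : ¬ (k + 1).Coprime P) (R₁ R₂ : ℕ) :
    #{r ∈ Ioc R₁ R₂ | (r * P + (k + 1)).Prime} = 0 := by
  refine card_eq_zero.2 (filter_eq_empty_iff.2 fun r hr hprime ↦ ?_)
  rw [mem_Ioc] at hr
  obtain ⟨p, hp, hpk, hpP⟩ := Nat.Prime.not_coprime_iff_dvd.1 hk
  have hpn : p ∣ r * P + (k + 1) := dvd_add (dvd_mul_of_dvd_right hpP r) hpk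
  have hpeq : p = r * P + (k + 1) := (Nat.prime_dvd_prime_iff_eq hp hprime).1 hpn
  have hple : p ≤ P := Nat.le_of_dvd hP hpP
  have hr1 : 1 ≤ r := by omega
  have : P ≤ r * P := Nat.le_mul_of_pos_left P hr1
  omega

/-! ## Column sums against `ψ(·; P, j)` -/

/-- Splitting a filtered sum over `range (M+1)` at `N ≤ M`. [folklore] -/
theorem sum_filter_range_succ_sub {N M : ℕ} (hNM : N ≤ M) (Q : ℕ → Prop) [DecidablePred Q]
    (g : ℕ → ℝ) :
    ∑ n ∈ (range (M + 1)).filter Q, g n - ∑ n ∈ (range (N + 1)).filter Q, g n =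
      ∑ n ∈ (Ioc N M).filter Q, g n := by
  rw [sum_filter, sum_filter, sum_filter, range_eq_Ico, range_eq_Ico,
    ← sum_Ico_consecutive _ (Nat.zero_le (N + 1)) (by omega : N + 1 ≤ M + 1)]
  have : Ico (N + 1) (M + 1) = Ioc N M := by ext n; simp only [mem_Ico, mem_Ioc]; omega
  rw [this]; ring

/-- **The log-weighted column sum is a `ϑ(·; P, j)`-difference**:
`∑_{R₁ < r ≤ R₂, rP+j prime} log(rP + j) = ϑ(R₂P + j; P, j) − ϑ(R₁P + j; P, j)` where
`ϑ(M; P, j) = ∑_{p ≤ M, p ≡ j (P)} log p`. [folklore] -/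
theorem columnLogSum_eq {P : ℕ} (hP : 0 < P) (j R₁ R₂ : ℕ) (hR : R₁ ≤ R₂) :
    ∑ r ∈ Ioc R₁ R₂, (if (r * P + j).Prime then Real.log ((r * P + j : ℕ) : ℝ) else 0) =
      ∑ p ∈ (range (R₂ * P + j + 1)).filter (fun p ↦ p.Prime ∧ p ≡ j [MOD P]), Real.log p -
        ∑ p ∈ (range (R₁ * P + j + 1)).filter (fun p ↦ p.Prime ∧ p ≡ j [MOD P]), Real.log p := by
  classical
  rw [sum_filter_range_succ_sub (by nlinarith : R₁ * P + j ≤ R₂ * P + j),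
    sum_Ioc_mul_add_eq (fun n ↦ if n.Prime then Real.log n else 0) hP j R₁ R₂, sum_filter,
    sum_filter]
  refine sum_congr rfl fun n _ ↦ ?_
  by_cases h1 : n ≡ j [MOD P]
  · by_cases h2 : n.Prime
    · simp [h1, h2]
    · simp [h1, h2]
  · simp [h1]

/-- **Lower bound for the log-weighted column sum** (Chebyshev–`ψ` sandwich,
Montgomery–Vaughan proof of Cor. 11.20): with `M₂ = R₂P + j`, `M₁ = R₁P + j`, `R₁ ≤ R₂`,
`∑_{R₁<r≤R₂, rP+j prime} log(rP+j) ≥ ψ(M₂; P, j) − (ψ(M₂) − ϑ(M₂)) − ψ(M₁; P, j)`.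
[cite: MontgomeryVaughan2007, proof of Cor. 11.20] -/
theorem columnLogSum_ge {P : ℕ} (hP : 0 < P) (j R₁ R₂ : ℕ) (hR : R₁ ≤ R₂) :
    chebyshevPsiMod P (j : ZMod P) ((R₂ * P + j : ℕ) : ℝ) -
        (Chebyshev.psi ((R₂ * P + j : ℕ) : ℝ) - Chebyshev.theta ((R₂ * P + j : ℕ) : ℝ)) -
        chebyshevPsiMod P (j : ZMod P) ((R₁ * P + j : ℕ) : ℝ) ≤
      ∑ r ∈ Ioc R₁ R₂, (if (r * P + j).Prime then Real.log ((r * P + j : ℕ) : ℝ) else 0) := by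
  rw [columnLogSum_eq hP j R₁ R₂ hR]
  have h2 := (Literature.NumberTheory.Sieve.sum_log_prime_modEq_le_chebyshevPsiMod (q := P) j (R₂ * P + j)).2
  have h1 := (Literature.NumberTheory.Sieve.sum_log_prime_modEq_le_chebyshevPsiMod (q := P) j (R₁ * P + j)).1
  linarith

/-- **Upper bound for the log-weighted column sum**:
`∑_{R₁<r≤R₂, rP+j prime} log(rP+j) ≤ ψ(M₂; P, j) − ψ(M₁; P, j) + (ψ(M₁) − ϑ(M₁))`.
[cite: MontgomeryVaughan2007, proof of Cor. 11.20] -/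
theorem columnLogSum_le {P : ℕ} (hP : 0 < P) (j R₁ R₂ : ℕ) (hR : R₁ ≤ R₂) :
    ∑ r ∈ Ioc R₁ R₂, (if (r * P + j).Prime then Real.log ((r * P + j : ℕ) : ℝ) else 0) ≤
      chebyshevPsiMod P (j : ZMod P) ((R₂ * P + j : ℕ) : ℝ) -
        chebyshevPsiMod P (j : ZMod P) ((R₁ * P + j : ℕ) : ℝ) +
        (Chebyshev.psi ((R₁ * P + j : ℕ) : ℝ) - Chebyshev.theta ((R₁ * P + j : ℕ) : ℝ)) := by
  rw [columnLogSum_eq hP j R₁ R₂ hR]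
  have h2 := (Literature.NumberTheory.Sieve.sum_log_prime_modEq_le_chebyshevPsiMod (q := P) j (R₂ * P + j)).1
  have h1 := (Literature.NumberTheory.Sieve.sum_log_prime_modEq_le_chebyshevPsiMod (q := P) j (R₁ * P + j)).2
  linarith

/-- The column count against its log-weighted sum, from above: every entry of the column is
`≤ R₂P + j`, so `∑ log(rP+j) ≤ C_j log(R₂P + j)`. [folklore] -/
theorem columnLogSum_le_card_mul_log (P j R₁ R₂ : ℕ) :
    ∑ r ∈ Ioc R₁ R₂, (if (r * P + j).Prime then Real.log ((r * P + j : ℕ) : ℝ) else 0) ≤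
      #{r ∈ Ioc R₁ R₂ | (r * P + j).Prime} * Real.log ((R₂ * P + j : ℕ) : ℝ) := by
  rw [card_filter, Nat.cast_sum, sum_mul]
  refine sum_le_sum fun r hr ↦ ?_
  rw [mem_Ioc] at hr
  split_ifs with hpr
  · rw [Nat.cast_one, one_mul]
    exact Real.log_le_log (by exact_mod_cast hpr.pos)
      (by exact_mod_cast Nat.add_le_add_right (Nat.mul_le_mul_right P hr.2) j)
  · simp

/-- The column count against its log-weighted sum, from below: every entry of the column is
`≥ (R₁ + 1)P`, so `C_j log((R₁+1)P) ≤ ∑ log(rP+j)`. [folklore] -/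
theorem card_mul_log_le_columnLogSum {P : ℕ} (hP : 0 < P) (j R₁ R₂ : ℕ) :
    #{r ∈ Ioc R₁ R₂ | (r * P + j).Prime} * Real.log (((R₁ + 1) * P : ℕ) : ℝ) ≤
      ∑ r ∈ Ioc R₁ R₂, (if (r * P + j).Prime then Real.log ((r * P + j : ℕ) : ℝ) else 0) := by
  rw [card_filter, Nat.cast_sum, sum_mul]
  refine sum_le_sum fun r hr ↦ ?_
  rw [mem_Ioc] at hr
  split_ifs with hpr
  · rw [Nat.cast_one, one_mul]
    have h0 : 0 < (R₁ + 1) * P := Nat.mul_pos (Nat.succ_pos _) hP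
    exact Real.log_le_log (by exact_mod_cast h0)
      (by exact_mod_cast (Nat.mul_le_mul_right P hr.1).trans (Nat.le_add_right _ j))
  · simp

/-! ## The core estimates of the matrix method -/

/-- Chebyshev's `ψ(M) − ϑ(M) ≤ 2√M log M ≤ 2√(3N) log(3N)` for `1 ≤ M ≤ 3N`. [folklore] -/
theorem psi_sub_theta_le_of_le {M N : ℕ} (hM1 : 1 ≤ M) (hM : M ≤ 3 * N) :
    Chebyshev.psi (M : ℝ) - Chebyshev.theta (M : ℝ) ≤
      2 * Real.sqrt (3 * N) * Real.log (3 * N) := by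
  have hM1' : (1 : ℝ) ≤ M := by exact_mod_cast hM1
  have hM' : (M : ℝ) ≤ 3 * N := by exact_mod_cast hM
  have h := Chebyshev.psi_sub_theta_le hM1'
  have h1 : Real.sqrt (M : ℝ) ≤ Real.sqrt (3 * N) := Real.sqrt_le_sqrt hM'
  have h2 : Real.log (M : ℝ) ≤ Real.log (3 * N) := Real.log_le_log (by linarith) hM'
  have h3 : 0 ≤ Real.log (M : ℝ) := Real.log_nonneg hM1'
  have h4 : 0 ≤ Real.sqrt (3 * (N : ℝ)) := Real.sqrt_nonneg _
  calc Chebyshev.psi (M : ℝ) - Chebyshev.theta (M : ℝ) ≤ 2 * Real.sqrt M * Real.log M := h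
    _ ≤ 2 * Real.sqrt (3 * N) * Real.log (3 * N) := by
        gcongr

/-- **Column bounds.** Let `0 < P`, `h < P`, `2P ≤ N`, and suppose `ψ(x; P, j)` is within a factor
`1 ± ε` of `x/φ(P)` at `x = N, 2N` for the reduced residue `j`, `1 ≤ j ≤ h`, while
`φ(P)·3√(3N) log(3N) ≤ εN`. Then the column of `j` in the matrix `(rP + j)`,
`⌊N/P⌋ < r ≤ ⌊2N/P⌋`, contains `C_j` primes with
`(1 − 4ε) N/φ(P) ≤ C_j log(3N)` and `C_j log N ≤ (1 + 4ε) N/φ(P)`.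
[cite: Soundararajan2007Distribution, Lecture 3 (3.2)] -/
theorem column_bounds {P N h j : ℕ} {ε : ℝ} (hP : 0 < P) (hhP : h < P) (hPN : 2 * P ≤ N)
    (hj1 : 1 ≤ j) (hjh : j ≤ h)
    (habs : (Nat.totient P : ℝ) * (3 * Real.sqrt (3 * N) * Real.log (3 * N)) ≤ ε * N)
    (hN : |chebyshevPsiMod P (j : ZMod P) N - N / Nat.totient P| ≤ ε * (N / Nat.totient P))
    (h2N : |chebyshevPsiMod P (j : ZMod P) ((2 * N : ℕ) : ℝ) - 2 * N / Nat.totient P| ≤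
      ε * (2 * N / Nat.totient P)) :
    (1 - 4 * ε) * N / Nat.totient P ≤
        #{r ∈ Ioc (N / P) (2 * N / P) | (r * P + j).Prime} * Real.log (3 * N) ∧
      #{r ∈ Ioc (N / P) (2 * N / P) | (r * P + j).Prime} * Real.log N ≤
        (1 + 4 * ε) * N / Nat.totient P := by
  set R₁ := N / P with hR₁
  set R₂ := 2 * N / P with hR₂
  have hφ0 : (0 : ℝ) < Nat.totient P := by exact_mod_cast Nat.totient_pos.2 hP
  have hN2 : 2 ≤ N := le_trans (by omega) hPN
  have hN0 : (0 : ℝ) < N := by exact_mod_cast (by omega : 0 < N)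
  have hR : R₁ ≤ R₂ := Nat.div_le_div_right (by omega)
  have hR₁P : R₁ * P ≤ N := Nat.div_mul_le_self N P
  have hR₂P : R₂ * P ≤ 2 * N := Nat.div_mul_le_self (2 * N) P
  have hNlt : N < R₁ * P + P := Nat.lt_div_mul_add hP
  -- monotonicity of `ψ(·; P, j)` in the real argument
  have mono : ∀ {u v : ℝ}, u ≤ v → chebyshevPsiMod P (j : ZMod P) u ≤ chebyshevPsiMod P (j : ZMod P) v := by
    intro u v huv
    unfold chebyshevPsiMod
    exact sum_le_sum_of_subset_of_nonneg (range_subset_range.2 (Nat.succ_le_succ (Nat.floor_mono huv)))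
      fun n _ _ ↦ ArithmeticFunction.vonMangoldt.residueClass_nonneg _ n
  -- the four `ψ(·; P, j)` comparisons
  have hup2 : chebyshevPsiMod P (j : ZMod P) ((2 * N : ℕ) : ℝ) ≤
      chebyshevPsiMod P (j : ZMod P) ((R₂ * P + j : ℕ) : ℝ) := chebyshevPsiMod_le_div_mul_add hP j (2 * N)
  have hup1 : chebyshevPsiMod P (j : ZMod P) (N : ℝ) ≤
      chebyshevPsiMod P (j : ZMod P) ((R₁ * P + j : ℕ) : ℝ) := chebyshevPsiMod_le_div_mul_add hP j N
  have hdown1 : chebyshevPsiMod P (j : ZMod P) ((R₁ * P + j : ℕ) : ℝ) ≤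
      chebyshevPsiMod P (j : ZMod P) N + Real.log ((N + h : ℕ) : ℝ) :=
    (mono (by exact_mod_cast (by omega : R₁ * P + j ≤ N + h))).trans
      (chebyshevPsiMod_add_le hhP j N)
  have hdown2 : chebyshevPsiMod P (j : ZMod P) ((R₂ * P + j : ℕ) : ℝ) ≤
      chebyshevPsiMod P (j : ZMod P) ((2 * N : ℕ) : ℝ) + Real.log ((2 * N + h : ℕ) : ℝ) :=
    (mono (by exact_mod_cast (by omega : R₂ * P + j ≤ 2 * N + h))).trans
      (chebyshevPsiMod_add_le hhP j (2 * N))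
  -- Chebyshev terms and the two logarithms against `√(3N) log(3N)`
  have hC2 := psi_sub_theta_le_of_le (M := R₂ * P + j) (N := N) (by omega) (by omega)
  have hC1 := psi_sub_theta_le_of_le (M := R₁ * P + j) (N := N) (by omega) (by omega)
  have h3N1 : (1 : ℝ) ≤ 3 * N := by
    have : (2 : ℝ) ≤ N := by exact_mod_cast hN2
    linarith
  have hsqrt1 : 1 ≤ Real.sqrt (3 * N) := by rw [Real.le_sqrt' one_pos, one_pow]; exact h3N1
  have hlog3N0 : 0 ≤ Real.log (3 * N) := Real.log_nonneg h3N1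
  have hlogle : ∀ M : ℕ, M ≤ 3 * N → Real.log (M : ℝ) ≤ Real.sqrt (3 * N) * Real.log (3 * N) := by
    intro M hM
    rcases Nat.eq_zero_or_pos M with rfl | hM0
    · simp only [Nat.cast_zero, Real.log_zero]; positivity
    · calc Real.log (M : ℝ) ≤ Real.log (3 * N) :=
            Real.log_le_log (by exact_mod_cast hM0) (by exact_mod_cast hM)
        _ = 1 * Real.log (3 * N) := (one_mul _).symm
        _ ≤ Real.sqrt (3 * N) * Real.log (3 * N) := mul_le_mul_of_nonneg_right hsqrt1 hlog3N0
  have hl1 := hlogle (N + h) (by omega)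
  have hl2 := hlogle (2 * N + h) (by omega)
  -- the PNT inputs, unpacked
  rw [abs_le] at hN h2N
  have hErr : 3 * Real.sqrt (3 * N) * Real.log (3 * N) ≤ ε * N / Nat.totient P := by
    rw [le_div_iff₀ hφ0]; linarith
  -- the log-weighted column sum
  have hSlo := columnLogSum_ge hP j R₁ R₂ hR
  have hShi := columnLogSum_le hP j R₁ R₂ hR
  set S := ∑ r ∈ Ioc R₁ R₂, (if (r * P + j).Prime then Real.log ((r * P + j : ℕ) : ℝ) else 0)
    with hSdef
  have hS1 : (1 - 4 * ε) * N / Nat.totient P ≤ S := by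
    have e : (1 - 4 * ε) * N / Nat.totient P =
        2 * N / Nat.totient P - ε * (2 * N / Nat.totient P) - (N / Nat.totient P + ε * (N / Nat.totient P))
          - ε * N / Nat.totient P := by ring
    rw [e]
    linarith
  have hS2 : S ≤ (1 + 4 * ε) * N / Nat.totient P := by
    have e : (1 + 4 * ε) * N / Nat.totient P =
        2 * N / Nat.totient P + ε * (2 * N / Nat.totient P) - (N / Nat.totient P - ε * (N / Nat.totient P))
          + ε * N / Nat.totient P := by ring
    rw [e]
    linarith
  -- against the column count
  have hcard0 : (0 : ℝ) ≤ #{r ∈ Ioc R₁ R₂ | (r * P + j).Prime} := Nat.cast_nonneg _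
  constructor
  · refine hS1.trans ((columnLogSum_le_card_mul_log P j R₁ R₂).trans ?_)
    refine mul_le_mul_of_nonneg_left (Real.log_le_log ?_ ?_) hcard0
    · exact_mod_cast (by omega : 0 < R₂ * P + j)
    · exact_mod_cast (by omega : R₂ * P + j ≤ 3 * N)
  · refine le_trans ?_ ((card_mul_log_le_columnLogSum hP j R₁ R₂).trans hS2)
    refine mul_le_mul_of_nonneg_left (Real.log_le_log hN0 ?_) hcard0
    exact_mod_cast (by nlinarith : N ≤ (R₁ + 1) * P)

/-- The number of rows `ρ = ⌊2N/P⌋ − ⌊N/P⌋` satisfies `(N − P)/P ≤ ρ ≤ (N + P)/P`. [folklore] -/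
theorem card_rows_bounds {P N : ℕ} (hP : 0 < P) :
    ((N : ℝ) - P) / P ≤ #(Ioc (N / P) (2 * N / P)) ∧ (#(Ioc (N / P) (2 * N / P)) : ℝ) ≤ (N + P) / P := by
  have hP0 : (0 : ℝ) < P := by exact_mod_cast hP
  have hR : N / P ≤ 2 * N / P := Nat.div_le_div_right (by omega)
  have i1 := Nat.cast_le (α := ℝ).2 (Nat.div_mul_le_self N P)
  have i2 := Nat.cast_le (α := ℝ).2 (Nat.div_mul_le_self (2 * N) P)
  have i3 := Nat.cast_lt (α := ℝ).2 (Nat.lt_div_mul_add (a := N) hP)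
  have i4 := Nat.cast_lt (α := ℝ).2 (Nat.lt_div_mul_add (a := 2 * N) hP)
  rw [Nat.cast_mul] at i1 i2
  rw [Nat.cast_add, Nat.cast_mul] at i3 i4
  rw [Nat.cast_mul, Nat.cast_ofNat] at i2 i4
  have hρ : (#(Ioc (N / P) (2 * N / P)) : ℝ) = ((2 * N / P : ℕ) : ℝ) - ((N / P : ℕ) : ℝ) := by
    rw [Nat.card_Ioc, Nat.cast_sub hR]
  rw [hρ]
  generalize ((N / P : ℕ) : ℝ) = a at i1 i3 ⊢
  generalize ((2 * N / P : ℕ) : ℝ) = b at i2 i4 ⊢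
  rw [div_le_iff₀ hP0, le_div_iff₀ hP0, sub_mul]
  constructor <;> linarith only [i1, i2, i3, i4]

/-- **A row with many primes.** Under the hypotheses of `column_bounds` for all reduced residues
`j ≤ h`, together with `P ≤ εN`, `0 < ε ≤ 1/8`: some row `r` of the matrix has at least
`N_c (P/φ(P)) (1 − 5ε)/log(3N)` primes among `rP + 1, …, rP + h`, where
`N_c = #{1 ≤ j ≤ h : (j, P) = 1}`. [cite: Soundararajan2007Distribution, Lecture 3 (3.1)–(3.3)] -/
theorem exists_row_ge {P N h : ℕ} {ε : ℝ} (hP : 0 < P) (hhP : h < P) (hPN : 2 * P ≤ N)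
    (hε0 : 0 < ε) (hε1 : ε ≤ 1 / 8) (hPε : (P : ℝ) ≤ ε * N)
    (habs : (Nat.totient P : ℝ) * (3 * Real.sqrt (3 * N) * Real.log (3 * N)) ≤ ε * N)
    (hN : ∀ j : ℕ, j.Coprime P →
      |chebyshevPsiMod P (j : ZMod P) N - N / Nat.totient P| ≤ ε * (N / Nat.totient P))
    (h2N : ∀ j : ℕ, j.Coprime P →
      |chebyshevPsiMod P (j : ZMod P) ((2 * N : ℕ) : ℝ) - 2 * N / Nat.totient P| ≤
        ε * (2 * N / Nat.totient P)) :
    ∃ r ∈ Ioc (N / P) (2 * N / P),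
      #{k ∈ range h | (k + 1).Coprime P} * ((P : ℝ) / Nat.totient P) * (1 - 5 * ε) / Real.log (3 * N) ≤
        #{k ∈ range h | (r * P + (k + 1)).Prime} := by
  classical
  have hφ0 : (0 : ℝ) < Nat.totient P := by exact_mod_cast Nat.totient_pos.2 hP
  have hP0 : (0 : ℝ) < P := by exact_mod_cast hP
  have hN2 : 2 ≤ N := le_trans (by omega) hPN
  have hN0 : (0 : ℝ) < N := by exact_mod_cast (by omega : 0 < N)
  have hlog3N : 0 < Real.log (3 * N) := Real.log_pos (by
    have : (2 : ℝ) ≤ N := by exact_mod_cast hN2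
    linarith)
  -- total count by columns
  set Tot : ℝ := ∑ r ∈ Ioc (N / P) (2 * N / P), (#{k ∈ range h | (r * P + (k + 1)).Prime} : ℝ) with hTot
  clear_value Tot
  have hTotcol := sum_rows_eq_sum_columns P h (N / P) (2 * N / P)
  have hφne : (Nat.totient P : ℝ) ≠ 0 := hφ0.ne'
  have hPne : (P : ℝ) ≠ 0 := hP0.ne'
  -- each coprime column is large, the others vanish
  have hcol : ∀ k ∈ range h, (if (k + 1).Coprime P then (1 : ℝ) else 0) * ((1 - 4 * ε) * N / Nat.totient P) ≤
      #{r ∈ Ioc (N / P) (2 * N / P) | (r * P + (k + 1)).Prime} * Real.log (3 * N) := by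
    intro k hk
    have hkh : k + 1 ≤ h := mem_range.1 hk
    by_cases hcop : (k + 1).Coprime P
    · rw [if_pos hcop, one_mul]
      exact (column_bounds hP hhP hPN (Nat.le_add_left 1 k) hkh habs (hN (k + 1) hcop)
        (h2N (k + 1) hcop)).1
    · rw [if_neg hcop, zero_mul]
      positivity
  have hTot_ge : #{k ∈ range h | (k + 1).Coprime P} * ((1 - 4 * ε) * N / Nat.totient P) ≤
      Tot * Real.log (3 * N) := by
    rw [hTot, hTotcol, sum_mul, card_filter, Nat.cast_sum, sum_mul]
    refine sum_le_sum fun k hk ↦ ?_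
    push_cast
    exact hcol k hk
  -- rows
  obtain ⟨hρ1, hρ2⟩ := card_rows_bounds (N := N) hP
  have hρpos : (0 : ℝ) < #(Ioc (N / P) (2 * N / P)) := by
    refine lt_of_lt_of_le ?_ hρ1
    rw [lt_div_iff₀ hP0, zero_mul, sub_pos]
    exact_mod_cast (by omega : P < N)
  have hne : (Ioc (N / P) (2 * N / P)).Nonempty := card_pos.1 (Nat.cast_pos.1 hρpos)
  -- pigeonhole
  obtain ⟨r, hr, hle⟩ := exists_le_of_sum_le hne
    (f := fun _ ↦ Tot / #(Ioc (N / P) (2 * N / P)))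
    (g := fun r ↦ (#{k ∈ range h | (r * P + (k + 1)).Prime} : ℝ)) (by
      rw [sum_const, nsmul_eq_mul, mul_div_cancel₀ _ hρpos.ne', hTot])
  refine ⟨r, hr, le_trans ?_ hle⟩
  -- `N_c (P/φ)(1−5ε)/log(3N) ≤ Tot/ρ`
  rw [div_le_div_iff₀ hlog3N hρpos]
  have hTot0 : 0 ≤ Tot := by rw [hTot]; exact sum_nonneg fun _ _ ↦ Nat.cast_nonneg _
  have hNc0 : (0 : ℝ) ≤ #{k ∈ range h | (k + 1).Coprime P} := Nat.cast_nonneg _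
  -- `ρ ≤ (N+P)/P ≤ (1+ε) N/P`
  have hρ3 : (#(Ioc (N / P) (2 * N / P)) : ℝ) ≤ (1 + ε) * N / P := by
    refine hρ2.trans ?_
    rw [div_le_div_iff₀ hP0 hP0]
    nlinarith
  calc #{k ∈ range h | (k + 1).Coprime P} * ((P : ℝ) / Nat.totient P) * (1 - 5 * ε) *
        #(Ioc (N / P) (2 * N / P))
      ≤ #{k ∈ range h | (k + 1).Coprime P} * ((P : ℝ) / Nat.totient P) * (1 - 5 * ε) *
          ((1 + ε) * N / P) := by
        refine mul_le_mul_of_nonneg_left hρ3 ?_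
        have : 0 ≤ 1 - 5 * ε := by linarith
        positivity
    _ = #{k ∈ range h | (k + 1).Coprime P} * ((N : ℝ) / Nat.totient P) * ((1 - 5 * ε) * (1 + ε)) := by
        field_simp
    _ ≤ #{k ∈ range h | (k + 1).Coprime P} * ((N : ℝ) / Nat.totient P) * (1 - 4 * ε) := by
        refine mul_le_mul_of_nonneg_left (by nlinarith) (by positivity)
    _ = #{k ∈ range h | (k + 1).Coprime P} * ((1 - 4 * ε) * N / Nat.totient P) := by ring
    _ ≤ Tot * Real.log (3 * N) := hTot_ge

/-- **A row with few primes.** Under the same hypotheses some row `r` has at most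
`N_c (P/φ(P)) (1 + 7ε)/log N` primes among `rP + 1, …, rP + h`.
[cite: Soundararajan2007Distribution, Lecture 3 (3.1)–(3.3)] -/
theorem exists_row_le {P N h : ℕ} {ε : ℝ} (hP : 0 < P) (hhP : h < P) (hPN : 2 * P ≤ N)
    (hε0 : 0 < ε) (hε1 : ε ≤ 1 / 8) (hPε : (P : ℝ) ≤ ε * N)
    (habs : (Nat.totient P : ℝ) * (3 * Real.sqrt (3 * N) * Real.log (3 * N)) ≤ ε * N)
    (hN : ∀ j : ℕ, j.Coprime P →
      |chebyshevPsiMod P (j : ZMod P) N - N / Nat.totient P| ≤ ε * (N / Nat.totient P))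
    (h2N : ∀ j : ℕ, j.Coprime P →
      |chebyshevPsiMod P (j : ZMod P) ((2 * N : ℕ) : ℝ) - 2 * N / Nat.totient P| ≤
        ε * (2 * N / Nat.totient P)) :
    ∃ r ∈ Ioc (N / P) (2 * N / P),
      (#{k ∈ range h | (r * P + (k + 1)).Prime} : ℝ) ≤
        #{k ∈ range h | (k + 1).Coprime P} * ((P : ℝ) / Nat.totient P) * (1 + 7 * ε) / Real.log N := by
  classical
  have hφ0 : (0 : ℝ) < Nat.totient P := by exact_mod_cast Nat.totient_pos.2 hP
  have hP0 : (0 : ℝ) < P := by exact_mod_cast hP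
  have hN2 : 2 ≤ N := le_trans (by omega) hPN
  have hN0 : (0 : ℝ) < N := by exact_mod_cast (by omega : 0 < N)
  have hlogN : 0 < Real.log N := Real.log_pos (by exact_mod_cast (by omega : 1 < N))
  set Tot : ℝ := ∑ r ∈ Ioc (N / P) (2 * N / P), (#{k ∈ range h | (r * P + (k + 1)).Prime} : ℝ) with hTot
  clear_value Tot
  have hTotcol := sum_rows_eq_sum_columns P h (N / P) (2 * N / P)
  have hφne : (Nat.totient P : ℝ) ≠ 0 := hφ0.ne'
  have hPne : (P : ℝ) ≠ 0 := hP0.ne'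
  have hcol : ∀ k ∈ range h, #{r ∈ Ioc (N / P) (2 * N / P) | (r * P + (k + 1)).Prime} * Real.log N ≤
      (if (k + 1).Coprime P then (1 : ℝ) else 0) * ((1 + 4 * ε) * N / Nat.totient P) := by
    intro k hk
    have hkh : k + 1 ≤ h := mem_range.1 hk
    by_cases hcop : (k + 1).Coprime P
    · rw [if_pos hcop, one_mul]
      exact (column_bounds hP hhP hPN (Nat.le_add_left 1 k) hkh habs (hN (k + 1) hcop)
        (h2N (k + 1) hcop)).2
    · rw [if_neg hcop, zero_mul, card_column_eq_zero hP hcop, Nat.cast_zero, zero_mul]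
  have hTot_le : Tot * Real.log N ≤
      #{k ∈ range h | (k + 1).Coprime P} * ((1 + 4 * ε) * N / Nat.totient P) := by
    rw [hTot, hTotcol, sum_mul, card_filter, Nat.cast_sum, sum_mul]
    refine sum_le_sum fun k hk ↦ ?_
    push_cast
    exact hcol k hk
  obtain ⟨hρ1, hρ2⟩ := card_rows_bounds (N := N) hP
  have hρpos : (0 : ℝ) < #(Ioc (N / P) (2 * N / P)) := by
    refine lt_of_lt_of_le ?_ hρ1
    rw [lt_div_iff₀ hP0, zero_mul, sub_pos]
    exact_mod_cast (by omega : P < N)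
  have hne : (Ioc (N / P) (2 * N / P)).Nonempty := card_pos.1 (Nat.cast_pos.1 hρpos)
  obtain ⟨r, hr, hle⟩ := exists_le_of_sum_le hne
    (f := fun r ↦ (#{k ∈ range h | (r * P + (k + 1)).Prime} : ℝ))
    (g := fun _ ↦ Tot / #(Ioc (N / P) (2 * N / P))) (by
      rw [sum_const, nsmul_eq_mul, mul_div_cancel₀ _ hρpos.ne', hTot])
  refine ⟨r, hr, hle.trans ?_⟩
  -- `Tot/ρ ≤ N_c (P/φ)(1+7ε)/log N`
  rw [div_le_div_iff₀ hρpos hlogN]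
  have hNc0 : (0 : ℝ) ≤ #{k ∈ range h | (k + 1).Coprime P} := Nat.cast_nonneg _
  -- `ρ ≥ (N − P)/P ≥ (1 − ε)N/P`
  have hρ3 : (1 - ε) * N / P ≤ #(Ioc (N / P) (2 * N / P)) := by
    refine le_trans ?_ hρ1
    rw [div_le_div_iff₀ hP0 hP0]
    nlinarith
  have h1ε : 0 < 1 - ε := by linarith
  calc Tot * Real.log N ≤ #{k ∈ range h | (k + 1).Coprime P} * ((1 + 4 * ε) * N / Nat.totient P) := hTot_le
    _ = #{k ∈ range h | (k + 1).Coprime P} * ((N : ℝ) / Nat.totient P) * (1 + 4 * ε) := by ring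
    _ ≤ #{k ∈ range h | (k + 1).Coprime P} * ((N : ℝ) / Nat.totient P) * ((1 + 7 * ε) * (1 - ε)) := by
        refine mul_le_mul_of_nonneg_left (by nlinarith) (by positivity)
    _ = #{k ∈ range h | (k + 1).Coprime P} * ((P : ℝ) / Nat.totient P) * (1 + 7 * ε) *
          ((1 - ε) * N / P) := by
        field_simp
    _ ≤ #{k ∈ range h | (k + 1).Coprime P} * ((P : ℝ) / Nat.totient P) * (1 + 7 * ε) *
          #(Ioc (N / P) (2 * N / P)) :=
        mul_le_mul_of_nonneg_left hρ3 (by positivity)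

/-! ## Elementary asymptotics in `L = log N` -/

/-- For `θ₁ < θ₂`, `0 < κ` and any `C`: eventually `C L^{θ₁} ≤ κ L^{θ₂}`. [folklore] -/
theorem eventually_const_mul_rpow_le {θ₁ θ₂ C κ : ℝ} (hθ : θ₁ < θ₂) (hκ : 0 < κ) :
    ∀ᶠ L : ℝ in atTop, C * L ^ θ₁ ≤ κ * L ^ θ₂ := by
  filter_upwards [(tendsto_rpow_atTop (by linarith : 0 < θ₂ - θ₁)).eventually_ge_atTop (C / κ),
    eventually_gt_atTop (0 : ℝ)] with L hL hL0
  have h1 : C ≤ κ * L ^ (θ₂ - θ₁) := by rw [div_le_iff₀' hκ] at hL; exact hL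
  calc C * L ^ θ₁ ≤ κ * L ^ (θ₂ - θ₁) * L ^ θ₁ :=
        mul_le_mul_of_nonneg_right h1 (Real.rpow_nonneg hL0.le _)
    _ = κ * L ^ θ₂ := by rw [mul_assoc, ← Real.rpow_add hL0, sub_add_cancel]

/-- `(1 + a/L)^A → 1` as `L → ∞`. [folklore] -/
theorem tendsto_one_add_div_rpow (a A : ℝ) :
    Tendsto (fun L : ℝ ↦ (1 + a / L) ^ A) atTop (nhds 1) := by
  have h1 : Tendsto (fun L : ℝ ↦ 1 + a / L) atTop (nhds (1 + 0)) :=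
    tendsto_const_nhds.add (tendsto_const_nhds.div_atTop tendsto_id)
  rw [add_zero] at h1
  have h2 := ((Real.continuousAt_rpow_const 1 A (Or.inl one_ne_zero)).tendsto).comp h1
  rw [Real.one_rpow] at h2
  exact h2

/-- For `a ≥ 0`, `κ > 1` and real `A`: eventually `(L + a)^A ≤ κ L^A`. [folklore] -/
theorem eventually_add_rpow_le {a A κ : ℝ} (ha : 0 ≤ a) (hκ : 1 < κ) :
    ∀ᶠ L : ℝ in atTop, (L + a) ^ A ≤ κ * L ^ A := by
  filter_upwards [(tendsto_one_add_div_rpow a A).eventually (gt_mem_nhds hκ),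
    eventually_gt_atTop (0 : ℝ)] with L hL hL0
  have h1 : L + a = L * (1 + a / L) := by field_simp
  have h2 : 0 ≤ 1 + a / L := by positivity
  rw [h1, Real.mul_rpow hL0.le h2, mul_comm]
  exact mul_le_mul_of_nonneg_right hL.le (Real.rpow_nonneg hL0.le _)

/-- **The comparison of lengths.** For `a, b ≥ 0`, `A > 0` and `κ > 1`: eventually
`((L + a)^A + 1)(L + b) ≤ κ (L^A − 1) L` (both sides are `∼ L^{A+1}`). [folklore] -/
theorem eventually_lengths_le {a b A κ : ℝ} (ha : 0 ≤ a) (hb : 0 ≤ b) (hA : 0 < A) (hκ : 1 < κ) :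
    ∀ᶠ L : ℝ in atTop, ((L + a) ^ A + 1) * (L + b) ≤ κ * ((L ^ A - 1) * L) := by
  -- `t` with `(1 + t)^3 ≤ κ`
  set t : ℝ := min ((κ - 1) / 8) 1 with ht
  have ht0 : 0 < t := lt_min (by linarith) one_pos
  have ht1 : t ≤ 1 := min_le_right _ _
  have htκ : (1 + t) ^ 3 ≤ κ := by
    have h8 : t ≤ (κ - 1) / 8 := min_le_left _ _
    have ht2 : t ^ 2 ≤ t := by nlinarith
    have ht3 : t ^ 3 ≤ t := by nlinarith
    nlinarith
  have hpow := tendsto_rpow_atTop hA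
  filter_upwards [eventually_add_rpow_le (A := A) ha (by linarith : 1 < 1 + t / 2),
    hpow.eventually_ge_atTop (2 / t), hpow.eventually_ge_atTop ((1 + t) / t),
    eventually_ge_atTop (b / t), eventually_gt_atTop (0 : ℝ)] with L h1 h2 h3 h4 hL0
  have hLA0 : 0 < L ^ A := Real.rpow_pos_of_pos hL0 A
  -- (i) `(L+a)^A + 1 ≤ (1+t) L^A`
  have i1 : (L + a) ^ A + 1 ≤ (1 + t) * L ^ A := by
    have : 1 ≤ t / 2 * L ^ A := by
      rw [div_le_iff₀ ht0] at h2
      linarith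
    linarith
  -- (ii) `L + b ≤ (1+t) L`
  have i2 : L + b ≤ (1 + t) * L := by
    rw [div_le_iff₀ ht0] at h4
    linarith
  -- (iii) `L^A ≤ (1+t)(L^A − 1)`
  have i3 : L ^ A ≤ (1 + t) * (L ^ A - 1) := by
    rw [div_le_iff₀ ht0] at h3
    linarith
  have hpos1 : 0 ≤ (L + a) ^ A + 1 := by positivity
  calc ((L + a) ^ A + 1) * (L + b) ≤ ((1 + t) * L ^ A) * ((1 + t) * L) :=
        mul_le_mul i1 i2 (by positivity) (by positivity)
    _ ≤ ((1 + t) * ((1 + t) * (L ^ A - 1))) * ((1 + t) * L) := by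
        refine mul_le_mul_of_nonneg_right (mul_le_mul_of_nonneg_left i3 (by linarith)) (by positivity)
    _ = (1 + t) ^ 3 * ((L ^ A - 1) * L) := by ring
    _ ≤ κ * ((L ^ A - 1) * L) := by
        refine mul_le_mul_of_nonneg_right htκ ?_
        have : 1 ≤ L ^ A := by
          have := i3; nlinarith
        nlinarith

/-- Eventually `C (L + log 3) ≤ ε e^{L/4}`. [folklore] -/
theorem eventually_linear_le_exp {C ε : ℝ} (hC : 0 ≤ C) (hε : 0 < ε) :
    ∀ᶠ L : ℝ in atTop, C * (L + Real.log 3) ≤ ε * Real.exp (L / 4) := by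
  have hlog3 : 0 ≤ Real.log 3 := Real.log_nonneg (by norm_num)
  filter_upwards [eventually_ge_atTop (Real.log 3), eventually_ge_atTop (64 * C / ε),
    eventually_ge_atTop (0 : ℝ)] with L h1 h2 hL0
  -- `e^{L/4} ≥ (L/4)^2/2 = L^2/32`
  have hexp : (L / 4) ^ 2 / 2 ≤ Real.exp (L / 4) := by
    have := Real.pow_div_factorial_le_exp (L / 4) (by positivity) 2
    simpa [Nat.factorial] using this
  have h3 : C * (L + Real.log 3) ≤ 2 * C * L := by nlinarith
  have h4 : 2 * C * L ≤ ε * (L ^ 2 / 32) := by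
    rw [div_le_iff₀ hε] at h2
    nlinarith
  calc C * (L + Real.log 3) ≤ ε * (L ^ 2 / 32) := h3.trans h4
    _ = ε * ((L / 4) ^ 2 / 2) := by ring
    _ ≤ ε * Real.exp (L / 4) := mul_le_mul_of_nonneg_left hexp hε.le

/-- **Mertens in a window**: for `0 < c < b`,
`∑_{L^c < p ≤ L^b} 1/p → log b − log c` as `L → ∞`; stated as: for every `η > 0`, eventually
`|P(L^b) − P(L^c) − (log b − log c)| ≤ η` where `P(x) = ∑_{p ≤ x} 1/p`
(`Literature.NumberTheory.LFunctions.Mertens.primeRecipSum`; from the tree's Mertens theorem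
`Literature.NumberTheory.LFunctions.Mertens.tendsto_primeRecipSum_sub_loglog`, Hardy–Wright Thm 427,
and `log log L^b − log log L^c = log b − log c`). [cite: HardyWright2008, Thm 427] -/
theorem eventually_abs_primeRecipSum_window {c b η : ℝ} (hc : 0 < c) (hb : 0 < b) (hη : 0 < η) :
    ∀ᶠ L : ℝ in atTop,
      |Literature.NumberTheory.LFunctions.Mertens.primeRecipSum (L ^ b) -
          Literature.NumberTheory.LFunctions.Mertens.primeRecipSum (L ^ c) -
          (Real.log b - Real.log c)| ≤ η := by
  have hM := Literature.NumberTheory.LFunctions.Mertens.tendsto_primeRecipSum_sub_loglog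
  have hb' := hM.comp (tendsto_rpow_atTop hb)
  have hc' := hM.comp (tendsto_rpow_atTop hc)
  have hdiff := hb'.sub hc'
  rw [sub_self] at hdiff
  have hev := Metric.tendsto_nhds.1 hdiff η hη
  filter_upwards [hev, eventually_gt_atTop (1 : ℝ)] with L hL hL1
  rw [Real.dist_eq, sub_zero] at hL
  simp only [Function.comp_apply] at hL
  have hL0 : 0 < L := by linarith
  have hlogL : 0 < Real.log L := Real.log_pos hL1
  have e1 : Real.log (Real.log (L ^ b)) = Real.log b + Real.log (Real.log L) := by
    rw [Real.log_rpow hL0, Real.log_mul hb.ne' hlogL.ne']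
  have e2 : Real.log (Real.log (L ^ c)) = Real.log c + Real.log (Real.log L) := by
    rw [Real.log_rpow hL0, Real.log_mul hc.ne' hlogL.ne']
  rw [e1, e2] at hL
  have : Literature.NumberTheory.LFunctions.Mertens.primeRecipSum (L ^ b) -
      Literature.NumberTheory.LFunctions.Mertens.primeRecipSum (L ^ c) - (Real.log b - Real.log c) =
      Literature.NumberTheory.LFunctions.Mertens.primeRecipSum (L ^ b) - (Real.log b + Real.log (Real.log L)) -
        (Literature.NumberTheory.LFunctions.Mertens.primeRecipSum (L ^ c) - (Real.log c + Real.log (Real.log L))) := by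
    ring
  rw [this]
  exact hL.le

/-! ## Small combinatorial glue -/

/-- `#{0 ≤ i < h : Q(i+1)} = #{1 ≤ j ≤ h : Q(j)}`. [folklore] -/
theorem card_range_filter_succ (h : ℕ) (Q : ℕ → Prop) [DecidablePred Q] :
    #{i ∈ range h | Q (i + 1)} = #{j ∈ Icc 1 h | Q j} := by
  refine card_nbij' (fun i ↦ i + 1) (fun j ↦ j - 1) (fun i hi ↦ ?_) (fun j hj ↦ ?_) (fun i _ ↦ by simp)
    (fun j hj ↦ ?_)
  · simp only [mem_coe, mem_filter, mem_range] at hi ⊢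
    simp only [mem_Icc]
    exact ⟨⟨by omega, by omega⟩, hi.2⟩
  · simp only [mem_coe, mem_filter, mem_Icc] at hj ⊢
    simp only [mem_range]
    refine ⟨by omega, ?_⟩
    have : j - 1 + 1 = j := by omega
    rw [this]; exact hj.2
  · simp only [mem_coe, mem_filter, mem_Icc] at hj
    show j - 1 + 1 = j
    omega

/-- Removing one element `> w` from a set of numbers `> w` costs at most `1/w` in `∑ 1/p`.
[folklore] -/
theorem sum_inv_erase_ge {T : Finset ℕ} {w : ℝ} (hw : 0 < w) (hT : ∀ p ∈ T, w < p) (B : ℕ) :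
    ∑ p ∈ T, (p : ℝ)⁻¹ - w⁻¹ ≤ ∑ p ∈ T.erase B, (p : ℝ)⁻¹ ∧
      ∑ p ∈ T.erase B, (p : ℝ)⁻¹ ≤ ∑ p ∈ T, (p : ℝ)⁻¹ := by
  classical
  constructor
  · by_cases hB : B ∈ T
    · rw [sum_erase_eq_sub hB]
      have : (B : ℝ)⁻¹ ≤ w⁻¹ := by
        rw [inv_le_inv₀ (lt_trans hw (hT B hB)) hw]
        exact (hT B hB).le
      linarith
    · rw [erase_eq_of_notMem hB]
      have : 0 ≤ w⁻¹ := inv_nonneg.2 hw.le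
      linarith
  · exact sum_le_sum_of_subset_of_nonneg (erase_subset _ _) fun p _ _ ↦ inv_nonneg.2 (Nat.cast_nonneg p)

/-- A product of primes avoiding the prime (or `1`) `B` is coprime to `B`. [folklore] -/
theorem coprime_prod_of_notMem {S : Finset ℕ} (hS : ∀ p ∈ S, p.Prime) {B : ℕ} (hB : B = 1 ∨ B.Prime)
    (hBS : B ∉ S) : (∏ p ∈ S, p).Coprime B := by
  rcases hB with rfl | hB
  · exact Nat.coprime_one_right _
  · refine Nat.Coprime.prod_left fun p hp ↦ (Nat.coprime_primes (hS p hp) hB).2 ?_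
    rintro rfl
    exact hBS hp

end Literature.Barriers.Parity.Maier
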